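import Literature.NumberTheory.Transcendental.PseudoExpChain
import Literature.NumberTheory.Transcendental.PseudoExpGenericPoint
import Literature.NumberTheory.Transcendental.PseudoExpAmbient
import HarnessLib

/-!
# The ω-chain of a countable pseudo-exponential field: the step adjoining a generic point of a
free rotund variety (Kirby 2013 FPEF §3; Bays–Kirby 2018, Prop. 7.3, Lemma 8.3)

The strong exponential-algebraic closedness of Zilber's fields is obtained, in the constructions of
Zilber 2005 (§§3–5) / Kirby, *Finitely presented exponential fields* (A&NT 7 (2013), §3 and §6, the
strong exponential-algebraic closure) / Bays–Kirby 2018 (Thm 5.9, proof of Lemma 8.3), by adjoining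
to a partial exponential field `F` a **generic point** `(x̄, ȳ)` of an irreducible, free and rotund
subvariety `V ⊆ 𝔾ₐⁿ × 𝔾ₘⁿ` of dimension `n`, with `exp xᵢ := yᵢ`: the extension is strong because `V`
is rotund (Bays–Kirby Prop. 7.3: `td(M·b/A) ≥ rk M`), kernel-preserving because `V` is
multiplicatively free (Kirby 2013, Lemma 3.3: "the extension it defines has the same kernel as `F`
iff `I` is multiplicatively free"), and `x̄` is linearly independent over `D(F)` because `V` is
additively free (ibid., before Def. 3.2).

This file performs that step for the states `PseudoExpChain.PState A` of `PseudoExpChain.lean`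
(inside the countable ambient field `Ω ⊆ ℂ`, generic points supplied by
`PseudoExpGenericPoint.exists_isGenericPt`):

* `PseudoExpChain.aclSubfield S` — the relatively algebraically closed subfield `acl S` of `Ω`;
* `PState.stepSEAC` — given a code `(n, G, P)` (finitely many polynomials `G` cutting out
  `W = Z(G) ⊆ Ω^{2n}` and a finite parameter set `P`), if `W` is irreducible, meets the torus, is
  rotund, additively and multiplicatively free of dimension `n` (and the state satisfies its
  invariant): the field `k₁ = acl(s ∪ exp s ∪ P ∪ coeffs G)`, a generic point `z = (x, y)` of
  `I(W) ∩ k₁[X, Y]` in `Ω`, and the state with the `xᵢ` adjoined to the basis and logarithms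
  `log yᵢ`;
* the facts: `yᵢ ≠ 0`, `x` is linearly independent over the old domain (additive freeness), so
  the step is a good extension (`PState.inv_stepSEAC`, `PState.le_stepSEAC`); the old domain and
  its exponentials lie in `k₁`; the new exponentials are `exp xᵢ = yᵢ` (`E_stepSEAC_x`).

The kernel, strongness and genericity conclusions are drawn in `PseudoExpSEACStepAxioms.lean`.

## References

* J. Kirby, *Finitely presented exponential fields*, Algebra & Number Theory 7 (2013): §3
  (Def. 3.1–3.2, Lemma 3.3), §6.
* M. Bays, J. Kirby, *Pseudo-exponential maps, variants, and quasiminimality*, Algebra & Number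
  Theory 12 (2018): Prop. 7.3, Lemma 8.3 (proof).
* B. Zilber, *Pseudo-exponentiation on algebraically closed fields of characteristic zero*,
  Ann. Pure Appl. Logic 132 (2005), §3.
-/

noncomputable section

open Set Complex MvPolynomial

namespace Literature.NumberTheory.Transcendental

namespace PseudoExpChain

open GammaField

variable {A : AmbientData}

/-! ### The relatively algebraically closed subfield `acl S` -/

section AclSubfield

variable {F : Type*} [Field F] [CharZero F]

/-- The relative algebraic closure `acl S` of a subset of a field of characteristic zero, as a
subfield. [folklore] -/
def aclSubfield (S : Set F) : Subfield F where
  carrier := acl S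
  mul_mem' := mul_mem_acl
  one_mem' := one_mem_acl S
  add_mem' := add_mem_acl
  zero_mem' := zero_mem_acl S
  neg_mem' := neg_mem_acl
  inv_mem' _ := inv_mem_acl

/-- Membership in `aclSubfield S`. [folklore] -/
@[simp] theorem mem_aclSubfield {S : Set F} {x : F} : x ∈ aclSubfield S ↔ x ∈ acl S := Iff.rfl

/-- The carrier of `aclSubfield S` is `acl S`. [folklore] -/
theorem coe_aclSubfield (S : Set F) : ((aclSubfield S : Subfield F) : Set F) = acl S := rfl

end AclSubfield

/-! ### Room inside `Ω` -/

/-- No finite subset of `Ω` spans `Ω` in its own algebraic matroid (from room in `ℂ` and the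
restriction of the matroid, `PseudoExpAmbient.acl_eq_preimage`). [folklore] -/
theorem AmbientData.roomΩ (A : AmbientData) (S : Set A.Ω) (hS : S.Finite) :
    ∃ t : A.Ω, t ∉ acl S := by
  obtain ⟨t, htΩ, ht⟩ := A.room (((↑) : A.Ω → ℂ) '' S) (hS.image _)
  refine ⟨⟨t, htΩ⟩, ?_⟩
  rw [PseudoExpAmbient.acl_eq_preimage, mem_preimage]
  exact ht

namespace PState

/-! ### The data of the step -/

section Data

variable (σ : PState A) (h : σ.Inv)

/-- The exponentials of the basis vectors, as elements of `Ω` (this uses the invariant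
`cexp (w v) ∈ Ω`). [folklore] -/
def expImage : Finset A.Ω :=
  σ.s.attach.image fun v => (⟨cexp (σ.w v.1), h.cexp_mem v.1 v.2⟩ : A.Ω)

/-- Membership in `expImage`. [folklore] -/
theorem mem_expImage_iff {y : A.Ω} :
    y ∈ σ.expImage h ↔ ∃ v ∈ σ.s, (y : ℂ) = cexp (σ.w v) := by
  constructor
  · intro hy
    rw [expImage, Finset.mem_image] at hy
    obtain ⟨v, -, rfl⟩ := hy
    exact ⟨v.1, v.2, rfl⟩
  · rintro ⟨v, hv, hyv⟩
    rw [expImage, Finset.mem_image]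
    exact ⟨⟨v, hv⟩, Finset.mem_attach _ _, Subtype.ext hyv.symm⟩

variable {n : ℕ} (G : Finset (MvPolynomial (Fin n ⊕ Fin n) A.Ω)) (P : Finset A.Ω)

/-- The finite set generating the field `k₁` of the step: basis vectors, their exponentials, the
parameters `P` and the coefficients of the equations `G`. [folklore] -/
def S₀ : Finset A.Ω := σ.s ∪ σ.expImage h ∪ P ∪ G.biUnion MvPolynomial.coeffs

/-- The field `k₁ = acl(S₀)` over which the generic point is taken (relatively algebraically
closed in `Ω`, so that the old exponentials and their roots lie in it).
[cite: Kirby2013FPEF, §3 (loci over F)] -/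
def k₁ : Subfield A.Ω := aclSubfield ((σ.S₀ h G P : Finset A.Ω) : Set A.Ω)

/-- `S₀ ⊆ k₁`. [folklore] -/
theorem S₀_subset_k₁ : ((σ.S₀ h G P : Finset A.Ω) : Set A.Ω) ⊆ σ.k₁ h G P :=
  subset_acl _

/-- Room over `k₁`. [folklore] -/
theorem room_k₁ : ∀ s : ℕ, ∃ t : Fin s → A.Ω, AlgebraicIndependent (σ.k₁ h G P) t :=
  PseudoExpGenericPoint.room_of_forall_finite A.roomΩ (σ.k₁ h G P) (σ.S₀ h G P).finite_toSet
    (fun _ hx => hx)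

/-- The variety `W = Z(G) ⊆ Ω^{2n}` of the code. [folklore] -/
def W : Set (Fin n ⊕ Fin n → A.Ω) :=
  zeroLocus A.Ω (Ideal.span (↑G : Set (MvPolynomial (Fin n ⊕ Fin n) A.Ω)))

/-- The hypotheses of strong exponential-algebraic closedness for `W`: irreducible, meets the torus,
rotund, additively and multiplicatively free, of dimension `n`. [cite: Zilber2005, §3] -/
structure Hyp : Prop where
  /-- `W` is an irreducible closed set -/
  irr : IsIrreducibleClosed A.Ω (W G)
  /-- `W` meets the torus -/
  ne : (W G ∩ torusLocus A.Ω n).Nonempty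
  /-- `W ∩ Gⁿ` is rotund -/
  rot : IsRotund A.Ω n (W G ∩ torusLocus A.Ω n)
  /-- `W ∩ Gⁿ` is additively free -/
  addFree : IsAddFree A.Ω n (W G ∩ torusLocus A.Ω n)
  /-- `W ∩ Gⁿ` is multiplicatively free -/
  mulFree : IsMulFree A.Ω n (W G ∩ torusLocus A.Ω n)
  /-- `dim W = n` -/
  dim : zariskiDim A.Ω (W G) = n

/-- The ideal `P₁ = I(W) ∩ k₁[X, Y]` of `W` over `k₁`. [cite: Kirby2013FPEF, Def. 3.1 (the ideal I)] -/
def P₁ : Ideal (MvPolynomial (Fin n ⊕ Fin n) (σ.k₁ h G P)) :=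
  (vanishingIdeal A.Ω (W G)).comap (MvPolynomial.map (algebraMap (σ.k₁ h G P) A.Ω))

/-- Membership in `P₁`: vanishing on `W`. [folklore] -/
theorem mem_P₁_iff (p : MvPolynomial (Fin n ⊕ Fin n) (σ.k₁ h G P)) :
    p ∈ σ.P₁ h G P ↔ ∀ w ∈ W G, aeval w p = 0 := by
  rw [P₁, Ideal.mem_comap, mem_vanishingIdeal_iff]
  refine forall₂_congr fun w _ => ?_
  rw [aeval_map_algebraMap]

/-- `P₁` is prime when `W` is irreducible. [folklore] -/
theorem P₁_isPrime (hW : IsIrreducibleClosed A.Ω (W G)) : (σ.P₁ h G P).IsPrime := by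
  haveI := hW.2
  exact Ideal.comap_isPrime _ _

end Data

/-! ### The generic point -/

section Generic

variable (σ : PState A) (h : σ.Inv) {n : ℕ} (G : Finset (MvPolynomial (Fin n ⊕ Fin n) A.Ω))
  (P : Finset A.Ω) (hW : IsIrreducibleClosed A.Ω (W G))

/-- **The generic point** of `P₁` in `Ω` (chosen, `PseudoExpGenericPoint.exists_isGenericPt`).
[cite: Kirby2013FPEF, §3 (a generic point of the locus)] -/
def genPt : Fin n ⊕ Fin n → A.Ω :=
  haveI := σ.P₁_isPrime h G P hW
  Classical.choose (PseudoExpGenericPoint.exists_isGenericPt (σ.k₁ h G P) (σ.room_k₁ h G P) (σ.P₁ h G P))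

/-- The generic point is generic: `I(z/k₁) = P₁`. [folklore] -/
theorem isGenericPt_genPt :
    haveI := σ.P₁_isPrime h G P hW
    IsGenericPt (σ.P₁ h G P) (σ.genPt h G P hW) := by
  haveI := σ.P₁_isPrime h G P hW
  exact Classical.choose_spec
    (PseudoExpGenericPoint.exists_isGenericPt (σ.k₁ h G P) (σ.room_k₁ h G P) (σ.P₁ h G P))

/-- The generic point lies on `W`. [folklore] -/
theorem genPt_mem_W : σ.genPt h G P hW ∈ W G := by
  have hgen := σ.isGenericPt_genPt h G P hW
  -- every generator `g ∈ G` has coefficients in `k₁`, hence comes from `P₁`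
  rw [W, zeroLocus_span]
  intro g hg
  have hcoef : (↑g.coeffs : Set A.Ω) ⊆ Set.range (algebraMap (σ.k₁ h G P) A.Ω) := by
    intro c hc
    refine ⟨⟨c, σ.S₀_subset_k₁ h G P ?_⟩, rfl⟩
    simp only [S₀, Finset.coe_union, Finset.coe_biUnion, Finset.mem_coe, Set.mem_union,
      Set.mem_iUnion]
    exact Or.inr ⟨g, hg, hc⟩
  obtain ⟨q, hq⟩ : g ∈ Set.range (MvPolynomial.map (algebraMap (σ.k₁ h G P) A.Ω)) := by
    rw [mem_range_map_iff_coeffs_subset]; exact hcoef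
  have hqP : q ∈ σ.P₁ h G P := by
    rw [mem_P₁_iff]
    intro w hw
    rw [← aeval_map_algebraMap A.Ω w q, hq]
    rw [W, zeroLocus_span] at hw
    exact hw g hg
  have := (hgen q).2 hqP
  rwa [← aeval_map_algebraMap A.Ω (σ.genPt h G P hW) q, hq] at this

/-- A polynomial over `k₁` vanishing at the generic point vanishes on `W`. [folklore] -/
theorem forall_W_of_aeval_genPt {p : MvPolynomial (Fin n ⊕ Fin n) (σ.k₁ h G P)}
    (hp : aeval (σ.genPt h G P hW) p = 0) : ∀ w ∈ W G, aeval w p = 0 :=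
  (σ.mem_P₁_iff h G P p).1 ((σ.isGenericPt_genPt h G P hW p).1 hp)

/-- **The multiplicative coordinates of the generic point are non-zero** when `W` meets the
torus: otherwise `Yᵢ ∈ I(z/k₁) = P₁` would vanish on `W`. [folklore] -/
theorem genPt_inr_ne_zero (hne : (W G ∩ torusLocus A.Ω n).Nonempty) (i : Fin n) :
    σ.genPt h G P hW (Sum.inr i) ≠ 0 := by
  intro h0
  obtain ⟨w, hwW, hwT⟩ := hne
  have h1 : aeval (σ.genPt h G P hW) (X (Sum.inr i) : MvPolynomial (Fin n ⊕ Fin n) (σ.k₁ h G P)) = 0 := by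
    rw [aeval_X, h0]
  have := σ.forall_W_of_aeval_genPt h G P hW h1 w hwW
  rw [aeval_X] at this
  exact hwT i this

/-- Elements of `D` lie in `k₁` (they are `ℚ`-combinations of `s ⊆ S₀`). [folklore] -/
theorem D_subset_k₁ {x : A.Ω} (hx : x ∈ σ.D) : x ∈ σ.k₁ h G P := by
  rw [k₁, mem_aclSubfield]
  refine acl_mono ?_ (subfieldClosure_subset_acl _ (Submodule.span_induction
    (p := fun y _ => y ∈ Subfield.closure ((σ.s : Set A.Ω)))
    (fun y hy => Subfield.subset_closure hy) (zero_mem _) (fun _ _ _ _ hx hy => add_mem hx hy)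
    (fun q y _ hy => ?_) hx))
  · intro y hy
    simp only [S₀, Finset.coe_union]
    exact Or.inl (Or.inl (Or.inl hy))
  · rw [Rat.smul_def]
    exact mul_mem (SubfieldClass.ratCast_mem _ q) hy

/-- **The additive coordinates of the generic point are linearly independent over `D`** when `W`
is additively free: a relation `∑ mᵢ xᵢ = d ∈ D ⊆ k₁` is a linear polynomial over `k₁` vanishing at
the generic point, hence on `W`, so `∑ mᵢ Xᵢ` would be constant on `W ∩ Gⁿ`.
[cite: Kirby2013FPEF, §3 (additively free ideals; generators independent over D(F))] -/
theorem genPt_linIndep (hadd : IsAddFree A.Ω n (W G ∩ torusLocus A.Ω n)) (m : Fin n → ℤ)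
    (hm : (∑ i, (m i : A.Ω) * σ.genPt h G P hW (Sum.inl i)) ∈ σ.D) : m = 0 := by
  classical
  by_contra hm0
  set c : A.Ω := ∑ i, (m i : A.Ω) * σ.genPt h G P hW (Sum.inl i) with hc
  have hck : c ∈ σ.k₁ h G P := σ.D_subset_k₁ h G P hm
  -- the linear polynomial `∑ mᵢ Xᵢ - c` over `k₁`
  set p : MvPolynomial (Fin n ⊕ Fin n) (σ.k₁ h G P) :=
    ∑ i, C ((m i : ℤ) : σ.k₁ h G P) * X (Sum.inl i) - C ⟨c, hck⟩ with hp
  have hpeval : ∀ w : Fin n ⊕ Fin n → A.Ω,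
      aeval w p = ∑ i, (m i : A.Ω) * w (Sum.inl i) - c := by
    intro w
    simp only [hp, map_sub, map_sum, map_mul, aeval_C, aeval_X, map_intCast]
    rfl
  have hpz : aeval (σ.genPt h G P hW) p = 0 := by rw [hpeval, hc, sub_self]
  refine hadd m hm0 ⟨c, fun w hw => ?_⟩
  have := σ.forall_W_of_aeval_genPt h G P hW hpz w hw.1
  rwa [hpeval, sub_eq_zero] at this

/-- The old exponentials lie in `k₁`: for `e ∈ D`, the element of `Ω` with value `E e` belongs to
`acl(s ∪ exp s) ⊆ k₁`. [folklore] -/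
theorem E_mem_k₁ {e : A.Ω} (he : e ∈ σ.D) :
    (⟨σ.E e, E_mem_Ω h he⟩ : A.Ω) ∈ σ.k₁ h G P := by
  rw [k₁, mem_aclSubfield, PseudoExpAmbient.acl_eq_preimage, mem_preimage]
  refine acl_subset_acl_of_subset ?_ (E_mem_acl_genℂ' h he)
  rintro c (⟨v, hv, rfl⟩ | ⟨v, hv, rfl⟩)
  · refine subset_acl _ ⟨v, ?_, rfl⟩
    simp only [S₀, Finset.coe_union, Set.mem_union, Finset.mem_coe]
    exact Or.inl (Or.inl (Or.inl hv))
  · refine subset_acl _ ⟨⟨cexp (σ.w v), h.cexp_mem v hv⟩, ?_, rfl⟩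
    simp only [S₀, Finset.coe_union, Set.mem_union, Finset.mem_coe]
    exact Or.inl (Or.inl (Or.inr ((σ.mem_expImage_iff h).2 ⟨v, hv, rfl⟩)))
where
  /-- The exponentials `E e`, `e ∈ D`, are algebraic over `genℂ` (as in
  `PseudoExpChainAxioms.lean`). [folklore] -/
  E_mem_acl_genℂ' {σ : PState A} (h : σ.Inv) {x : A.Ω} (hx : x ∈ σ.D) : σ.E x ∈ acl σ.genℂ := by
    induction hx using Submodule.span_induction with
    | mem v hv => rw [E_of_mem h.good hv]; exact subset_acl _ (σ.cexp_mem_genℂ hv)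
    | zero => rw [E_zero]; exact one_mem_acl _
    | add x y _ _ hx hy => rw [E_add]; exact mul_mem_acl hx hy
    | smul q x _ hx =>
      rw [E, map_smul]
      exact acl_subset_acl_of_subset (singleton_subset_iff.2 hx) (cexp_smul_mem_acl q _)

/-- Laurent monomials as quotients of monomials: `∏ yᵢ^{pᵢ} = ∏ yᵢ^{pᵢ⁺} / ∏ yᵢ^{pᵢ⁻}` for
non-zero `yᵢ`. [folklore] -/
theorem prod_zpow_eq_div' {K : Type*} [Field K] {m : ℕ} (y : Fin m → K) (hy : ∀ i, y i ≠ 0)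
    (p : Fin m → ℤ) :
    ∏ i, y i ^ p i = (∏ i, y i ^ (p i).toNat) / ∏ i, y i ^ (-p i).toNat := by
  rw [← Finset.prod_div_distrib]
  refine Finset.prod_congr rfl fun i _ => ?_
  rw [← zpow_natCast, ← zpow_natCast, ← zpow_sub₀ (hy i)]
  congr 1
  have := Int.toNat_sub_toNat_neg (p i)
  omega

/-- **No non-trivial monomial in the `yᵢ` is an old exponential** when `W` is multiplicatively free:
`∏ yᵢ^{pᵢ} = E d ∈ k₁` is a Laurent relation over `k₁` at the generic point, hence `∏ Yᵢ^{pᵢ}` would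
be constant on `W ∩ Gⁿ`. [cite: Kirby2013FPEF, Lemma 3.3 (multiplicatively free iff same kernel)] -/
theorem genPt_prod_zpow_ne (hne : (W G ∩ torusLocus A.Ω n).Nonempty)
    (hmul : IsMulFree A.Ω n (W G ∩ torusLocus A.Ω n)) (p : Fin n → ℤ) (hp : p ≠ 0)
    {d : A.Ω} (hd : d ∈ σ.D) :
    (∏ i, (σ.genPt h G P hW (Sum.inr i) : A.Ω) ^ p i) ≠ ⟨σ.E d, E_mem_Ω h hd⟩ := by
  classical
  intro heq
  set y : Fin n → A.Ω := fun i => σ.genPt h G P hW (Sum.inr i) with hy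
  have hy0 : ∀ i, y i ≠ 0 := fun i => σ.genPt_inr_ne_zero h G P hW hne i
  set c : σ.k₁ h G P := ⟨⟨σ.E d, E_mem_Ω h hd⟩, σ.E_mem_k₁ h G P hd⟩ with hc
  -- the Laurent relation as a polynomial over `k₁`
  set q : MvPolynomial (Fin n ⊕ Fin n) (σ.k₁ h G P) :=
    ∏ i, X (Sum.inr i) ^ (p i).toNat - C c * ∏ i, X (Sum.inr i) ^ (-p i).toNat with hq
  have hqeval : ∀ w : Fin n ⊕ Fin n → A.Ω, aeval w q =
      ∏ i, w (Sum.inr i) ^ (p i).toNat - (⟨σ.E d, E_mem_Ω h hd⟩ : A.Ω) * ∏ i, w (Sum.inr i) ^ (-p i).toNat := by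
    intro w
    simp only [hq, map_sub, map_mul, map_prod, map_pow, aeval_X, aeval_C]
    rfl
  have hqz : aeval (σ.genPt h G P hW) q = 0 := by
    rw [hqeval, sub_eq_zero]
    have h1 := prod_zpow_eq_div' y hy0 p
    have hden : (∏ i, y i ^ (-p i).toNat) ≠ 0 :=
      Finset.prod_ne_zero_iff.2 fun i _ => pow_ne_zero _ (hy0 i)
    rw [eq_div_iff hden] at h1
    change ∏ i, y i ^ (p i).toNat = _ * ∏ i, y i ^ (-p i).toNat
    rw [← h1, ← heq]
  refine hmul p hp ⟨⟨σ.E d, E_mem_Ω h hd⟩, fun w hw => ?_⟩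
  have hw0 : ∀ i, w (Sum.inr i) ≠ 0 := hw.2
  have := σ.forall_W_of_aeval_genPt h G P hW hqz w hw.1
  rw [hqeval, sub_eq_zero] at this
  rw [prod_zpow_eq_div' _ hw0, div_eq_iff
    (Finset.prod_ne_zero_iff.2 fun i _ => pow_ne_zero _ (hw0 i))]
  exact this

end Generic

/-! ### Adjoining a finite family of basis vectors -/

section Family

variable (σ : PState A) {n : ℕ} (x : Fin n → A.Ω) (ω : Fin n → ℂ)

/-- Adjoining the new basis vectors `x₁, …, xₙ` with logarithms `ω₁, …, ωₙ`. [folklore] -/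
def adjoinFamily : PState A := by
  classical
  exact ⟨σ.s ∪ Finset.univ.image x,
    fun v => if hv : ∃ i, x i = v then ω (Classical.choose hv) else σ.w v⟩

/-- The basis after `adjoinFamily`. [folklore] -/
theorem adjoinFamily_s : (σ.adjoinFamily x ω).s = σ.s ∪ Finset.univ.image x := by
  classical
  simp [adjoinFamily]

variable {x}

/-- The new logarithms. [folklore] -/
theorem adjoinFamily_w_x (hx : Function.Injective x) (i : Fin n) : (σ.adjoinFamily x ω).w (x i) = ω i := by
  classical
  have hex : ∃ j, x j = x i := ⟨i, rfl⟩
  simp only [adjoinFamily, dif_pos hex]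
  congr 1
  exact hx (Classical.choose_spec hex)

/-- The old logarithms are kept. [folklore] -/
theorem adjoinFamily_w_of_mem (hxs : ∀ i, x i ∉ σ.s) {v : A.Ω} (hv : v ∈ σ.s) :
    (σ.adjoinFamily x ω).w v = σ.w v := by
  classical
  have hnex : ¬ ∃ i, x i = v := fun ⟨i, hi⟩ => hxs i (hi ▸ hv)
  simp only [adjoinFamily, dif_neg hnex]

/-- The domain after `adjoinFamily` is `D + span(x)`. [folklore] -/
theorem adjoinFamily_D : (σ.adjoinFamily x ω).D = σ.D ⊔ Submodule.span ℚ (Set.range x) := by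
  classical
  rw [D, adjoinFamily_s, Finset.coe_union, Finset.coe_image, Finset.coe_univ, Set.image_univ,
    Submodule.span_union, D]

/-- `σ ≼ σ.adjoinFamily x ω` for new `x`. [folklore] -/
theorem le_adjoinFamily (hxs : ∀ i, x i ∉ σ.s) : σ.LE (σ.adjoinFamily x ω) :=
  ⟨by rw [adjoinFamily_s]; exact Finset.subset_union_left,
    fun _ hv => σ.adjoinFamily_w_of_mem ω hxs hv⟩

/-- `adjoinFamily` preserves the invariant for new, independent `x` with exponentials in `Ω`.
[folklore] -/
theorem Inv.adjoinFamily {σ : PState A} (h : σ.Inv) (hx : Function.Injective x)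
    (hxs : ∀ i, x i ∉ σ.s) (hlin : LinearIndepOn ℚ _root_.id ((σ.s : Set A.Ω) ∪ Set.range x))
    (hω : ∀ i, cexp (ω i) ∈ A.Ω) : (σ.adjoinFamily x ω).Inv where
  good := by
    change LinearIndepOn ℚ _root_.id (((σ.adjoinFamily x ω).s : Finset A.Ω) : Set A.Ω)
    rw [adjoinFamily_s, Finset.coe_union, Finset.coe_image, Finset.coe_univ, Set.image_univ]
    exact hlin
  τ_mem := by rw [adjoinFamily_s]; exact Finset.mem_union_left _ h.τ_mem
  w_τ := by rw [σ.adjoinFamily_w_of_mem ω hxs h.τ_mem, h.w_τ]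
  cexp_mem := by
    classical
    intro v hv
    rw [adjoinFamily_s, Finset.mem_union, Finset.mem_image] at hv
    by_cases hvx : ∃ i, x i = v
    · obtain ⟨i, rfl⟩ := hvx
      rw [σ.adjoinFamily_w_x ω hx i]; exact hω i
    · rcases hv with hv | ⟨i, -, hi⟩
      · rw [σ.adjoinFamily_w_of_mem ω hxs hv]; exact h.cexp_mem v hv
      · exact (hvx ⟨i, hi⟩).elim

/-- The new exponentials: `E (x i) = cexp (ω i)`. [folklore] -/
theorem E_adjoinFamily_x {σ : PState A} (h' : (σ.adjoinFamily x ω).Good) (hx : Function.Injective x)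
    (i : Fin n) : (σ.adjoinFamily x ω).E (x i) = cexp (ω i) := by
  classical
  rw [E_of_mem h' (by rw [adjoinFamily_s, Finset.mem_union, Finset.mem_image]; exact Or.inr ⟨i, Finset.mem_univ _, rfl⟩),
    σ.adjoinFamily_w_x ω hx i]

/-- **Adjoining a family is kernel-preserving** provided no non-trivial monomial in the new
exponentials is an old exponential (the analogue of `kInv_adjoin` for `n` vectors at once):
`E(d + ∑ qᵢ xᵢ) = E d · ∏ cexp(qᵢ ωᵢ) = 1` gives, with `N` a common denominator and `pᵢ = N qᵢ`,
`∏ cexp(ωᵢ)^{pᵢ} = E(-N d)`, so `p = 0`. [cite: Kirby2013FPEF, Lemma 3.3] -/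
theorem kInv_adjoinFamily {σ : PState A} (hK : ∀ e ∈ σ.D, σ.E e = 1 → ∃ m : ℤ, e = m • A.τ)
    (h : σ.Inv) (hx : Function.Injective x) (hxs : ∀ i, x i ∉ σ.s)
    (hlin : LinearIndepOn ℚ _root_.id ((σ.s : Set A.Ω) ∪ Set.range x)) (hω : ∀ i, cexp (ω i) ∈ A.Ω)
    (H : ∀ p : Fin n → ℤ, p ≠ 0 → ∀ d ∈ σ.D, (∏ i, cexp (ω i) ^ p i) ≠ σ.E d) :
    ∀ e ∈ (σ.adjoinFamily x ω).D, (σ.adjoinFamily x ω).E e = 1 → ∃ m : ℤ, e = m • A.τ := by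
  classical
  have h' : (σ.adjoinFamily x ω).Inv := h.adjoinFamily ω hx hxs hlin hω
  have hle : σ.LE (σ.adjoinFamily x ω) := σ.le_adjoinFamily ω hxs
  intro e he hEe
  rw [adjoinFamily_D, Submodule.mem_sup] at he
  obtain ⟨d, hd, u, hu, rfl⟩ := he
  obtain ⟨q, rfl⟩ := (Submodule.mem_span_range_iff_exists_fun ℚ).1 hu
  -- `E'(d + ∑ qᵢ xᵢ) = E d * ∏ cexp (qᵢ • ωᵢ)`
  have hEd : (σ.adjoinFamily x ω).E d = σ.E d := hle.E_eq h.good h'.good hd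
  have hEq : (σ.adjoinFamily x ω).E (∑ i, q i • x i) = ∏ i, cexp (q i • ω i) := by
    rw [E, map_sum, Complex.exp_sum]
    refine Finset.prod_congr rfl fun i _ => ?_
    rw [map_smul, Λ_apply_of_mem h'.good (by
      rw [adjoinFamily_s, Finset.mem_union, Finset.mem_image]
      exact Or.inr ⟨i, Finset.mem_univ _, rfl⟩), σ.adjoinFamily_w_x ω hx i]
  have hE : σ.E d * ∏ i, cexp (q i • ω i) = 1 := by rw [← hEe, E_add, hEd, hEq]
  -- common denominator
  set N : ℕ := ∏ i, (q i).den with hN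
  have hN0 : N ≠ 0 := Finset.prod_ne_zero_iff.mpr fun i _ => (q i).den_nz
  have hk : ∀ i, ∃ k : ℤ, (k : ℚ) = N * q i := by
    intro i
    refine ⟨(∏ j ∈ Finset.univ.erase i, ((q j).den : ℤ)) * (q i).num, ?_⟩
    rw [hN, ← Finset.prod_erase_mul _ _ (Finset.mem_univ i)]
    push_cast
    rw [mul_assoc, ← Rat.mul_den_eq_num, mul_comm (q i)]
  choose k hk using hk
  -- raise to the power `N`
  have hpow : σ.E ((N : ℚ) • d) * ∏ i, cexp (ω i) ^ k i = 1 := by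
    have h1 : (σ.E d * ∏ i, cexp (q i • ω i)) ^ N = 1 := by rw [hE, one_pow]
    rw [mul_pow, ← Finset.prod_pow] at h1
    have h2 : σ.E d ^ N = σ.E ((N : ℚ) • d) := by
      rw [E, E, map_smul, Nat.cast_smul_eq_nsmul ℚ, nsmul_eq_mul, Complex.exp_nat_mul]
    have h3 : ∀ i, cexp (q i • ω i) ^ N = cexp (ω i) ^ k i := by
      intro i
      rw [← Complex.exp_nat_mul, ← Complex.exp_int_mul]
      congr 1
      rw [Rat.smul_def, ← mul_assoc]
      congr 1
      have h' : ((N : ℚ) * q i : ℂ) = (k i : ℂ) := by exact_mod_cast (hk i).symm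
      push_cast at h' ⊢
      exact h'
    rw [h2, Finset.prod_congr rfl fun i _ => h3 i] at h1
    exact h1
  -- hence `∏ cexp(ωᵢ)^{kᵢ} = E(-N d)`, so `k = 0`
  have hk0 : k = 0 := by
    by_contra hne
    refine H k hne (-((N : ℚ) • d)) (Submodule.neg_mem _ (Submodule.smul_mem _ _ hd)) ?_
    have hne0 : σ.E ((N : ℚ) • d) ≠ 0 := E_ne_zero _ _
    rw [E, map_neg, Complex.exp_neg, ← E]
    field_simp
    rw [mul_comm] at hpow
    exact hpow
  have hq0 : q = 0 := by
    funext i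
    have hi : (N : ℚ) * q i = 0 := by rw [← hk i, hk0, Pi.zero_apply, Int.cast_zero]
    exact (mul_eq_zero.mp hi).resolve_left (Nat.cast_ne_zero.mpr hN0)
  subst hq0
  simp only [Pi.zero_apply, zero_smul, Finset.sum_const_zero, add_zero] at hEe ⊢
  rw [hEd] at hEe
  exact hK d hd hEe

end Family

/-! ### Independence bookkeeping -/

section Indep

variable {σ : PState A} {n : ℕ} {x : Fin n → A.Ω}

/-- From "no non-trivial `ℤ`-combination of the `xᵢ` lies in `D = span s`" and independence of
`s`: the `xᵢ` are pairwise distinct, new, and `s ∪ {xᵢ}` is linearly independent. [folklore] -/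
theorem indep_pack (hgood : σ.Good)
    (hint : ∀ m : Fin n → ℤ, (∑ i, (m i : A.Ω) * x i) ∈ σ.D → m = 0) :
    Function.Injective x ∧ (∀ i, x i ∉ σ.s) ∧
      LinearIndepOn ℚ _root_.id ((σ.s : Set A.Ω) ∪ Set.range x) := by
  classical
  have hli : LinIndepOver σ.D x :=
    ZilberSaturationMain.linIndepOver_of_forall_intCast σ.s rfl hint
  have hlin : LinearIndependent ℚ x := by
    rw [Fintype.linearIndependent_iff]
    intro q hq i
    have := hli q (by rw [hq]; exact Submodule.zero_mem _)
    exact congrFun this i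
  have hxD : ∀ i, x i ∉ σ.D := by
    intro i hi
    have := hli (Pi.single i 1) (by simpa [Pi.single_apply] using hi)
    have h1 := congrFun this i
    simp at h1
  refine ⟨hlin.injective, fun i hi => hxD i (σ.subset_D hi), ?_⟩
  refine hgood.id_union hlin.linearIndepOn_id ?_
  rw [Submodule.disjoint_def]
  intro v hv hvx
  obtain ⟨q, rfl⟩ := (Submodule.mem_span_range_iff_exists_fun ℚ).1 hvx
  have := hli q hv
  subst this
  simp

end Indep

/-! ### The step -/

section Step

variable {n : ℕ} (G : Finset (MvPolynomial (Fin n ⊕ Fin n) A.Ω)) (P : Finset A.Ω)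

/-- **The step adjoining a generic point of `W = Z(G)`** (if `W` satisfies the hypotheses of strong
exponential-algebraic closedness and the state its invariant; otherwise the state is unchanged):
the additive coordinates `xᵢ` of a generic point of `W` over `k₁ = acl(s ∪ exp s ∪ P ∪ coeffs G)`
are adjoined to the basis with logarithms `log yᵢ`, so that `exp xᵢ = yᵢ`.
[cite: Kirby2013FPEF, §3 and §6 (adjoining a generic point of V)] [cite: BaysKirby2018ANT, Lemma 8.3 (proof)] -/
def stepSEAC (σ : PState A) : PState A := by
  classical
  exact if h : σ.Inv ∧ Hyp G then
      σ.adjoinFamily (fun i => σ.genPt h.1 G P h.2.irr (Sum.inl i))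
        (fun i => Complex.log (σ.genPt h.1 G P h.2.irr (Sum.inr i) : ℂ))
    else σ

variable {G P}

/-- The data of the step, when it fires. [folklore] -/
theorem stepSEAC_eq_of {σ : PState A} (h : σ.Inv) (hH : Hyp G) :
    stepSEAC G P σ = σ.adjoinFamily (fun i => σ.genPt h G P hH.irr (Sum.inl i))
      (fun i => Complex.log (σ.genPt h G P hH.irr (Sum.inr i) : ℂ)) := by
  classical
  have h' : σ.Inv ∧ Hyp G := ⟨h, hH⟩
  rw [stepSEAC, dif_pos h']

/-- The step does nothing when the hypotheses fail. [folklore] -/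
theorem stepSEAC_eq_self_of {σ : PState A} (h : ¬ (σ.Inv ∧ Hyp G)) : stepSEAC G P σ = σ := by
  classical
  rw [stepSEAC, dif_neg h]

/-- The independence package for the generic point's additive coordinates. [folklore] -/
theorem indep_genPt {σ : PState A} (h : σ.Inv) (hH : Hyp G) :
    Function.Injective (fun i => σ.genPt h G P hH.irr (Sum.inl i)) ∧
      (∀ i, σ.genPt h G P hH.irr (Sum.inl i) ∉ σ.s) ∧
      LinearIndepOn ℚ _root_.id ((σ.s : Set A.Ω) ∪ Set.range fun i => σ.genPt h G P hH.irr (Sum.inl i)) :=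
  indep_pack h.good (σ.genPt_linIndep h G P hH.irr hH.addFree)

/-- The new exponentials lie in `Ω`: `cexp (log yᵢ) = yᵢ`. [folklore] -/
theorem cexp_log_genPt {σ : PState A} (h : σ.Inv) (hH : Hyp G) (i : Fin n) :
    cexp (Complex.log (σ.genPt h G P hH.irr (Sum.inr i) : ℂ)) = σ.genPt h G P hH.irr (Sum.inr i) := by
  refine Complex.exp_log ?_
  exact fun h0 => σ.genPt_inr_ne_zero h G P hH.irr hH.ne i (Subtype.ext h0)

/-- **The step extends the state.** [folklore] -/
theorem le_stepSEAC (σ : PState A) : σ.LE (stepSEAC G P σ) := by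
  classical
  by_cases h : σ.Inv ∧ Hyp G
  · rw [stepSEAC_eq_of h.1 h.2]
    exact σ.le_adjoinFamily _ (indep_genPt h.1 h.2).2.1
  · rw [stepSEAC_eq_self_of h]
    exact LE.refl σ

/-- **The step preserves the invariant.** [folklore] -/
theorem Inv.stepSEAC {σ : PState A} (h : σ.Inv) : (stepSEAC G P σ).Inv := by
  classical
  by_cases hH : Hyp G
  · rw [stepSEAC_eq_of h hH]
    obtain ⟨hx, hxs, hlin⟩ := indep_genPt (P := P) h hH
    refine h.adjoinFamily _ hx hxs hlin fun i => ?_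
    rw [cexp_log_genPt h hH]
    exact (σ.genPt h G P hH.irr (Sum.inr i)).2
  · rw [stepSEAC_eq_self_of (fun h' => hH h'.2)]
    exact h

/-- **The step is kernel-preserving** (multiplicative freeness). [cite: Kirby2013FPEF, Lemma 3.3] -/
theorem kInv_stepSEAC {σ : PState A} (hK : ∀ e ∈ σ.D, σ.E e = 1 → ∃ m : ℤ, e = m • A.τ)
    (h : σ.Inv) :
    ∀ e ∈ (stepSEAC G P σ).D, (stepSEAC G P σ).E e = 1 → ∃ m : ℤ, e = m • A.τ := by
  classical
  by_cases hH : Hyp G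
  · rw [stepSEAC_eq_of h hH]
    obtain ⟨hx, hxs, hlin⟩ := indep_genPt (P := P) h hH
    refine kInv_adjoinFamily _ hK h hx hxs hlin (fun i => ?_) ?_
    · rw [cexp_log_genPt h hH]
      exact (σ.genPt h G P hH.irr (Sum.inr i)).2
    · intro p hp d hd heq
      refine σ.genPt_prod_zpow_ne h G P hH.irr hH.ne hH.mulFree p hp hd (Subtype.ext ?_)
      show A.Ω.subtype (∏ i, σ.genPt h G P hH.irr (Sum.inr i) ^ p i) = σ.E d
      rw [← heq, map_prod A.Ω.subtype]
      refine Finset.prod_congr rfl fun i _ => ?_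
      rw [map_zpow₀ A.Ω.subtype, cexp_log_genPt h hH]
      rfl
  · rw [stepSEAC_eq_self_of (fun h' => hH h'.2)]
    exact hK

/-- **After the step, `W` has an exponential point**: the new exponentials are `E (xᵢ) = yᵢ`.
[cite: Kirby2013FPEF, §3] -/
theorem E_stepSEAC_x {σ : PState A} (h : σ.Inv) (hH : Hyp G) (i : Fin n) :
    (stepSEAC G P σ).E (σ.genPt h G P hH.irr (Sum.inl i)) = σ.genPt h G P hH.irr (Sum.inr i) := by
  classical
  rw [stepSEAC_eq_of h hH]
  obtain ⟨hx, hxs, hlin⟩ := indep_genPt (P := P) h hH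
  have h' := h.adjoinFamily (fun i => Complex.log (σ.genPt h G P hH.irr (Sum.inr i) : ℂ)) hx hxs hlin
    (fun i => by rw [cexp_log_genPt h hH]; exact (σ.genPt h G P hH.irr (Sum.inr i)).2)
  rw [E_adjoinFamily_x _ h'.good hx i, cexp_log_genPt h hH]

/-- The domain after the step, when it fires. [folklore] -/
theorem D_stepSEAC_of {σ : PState A} (h : σ.Inv) (hH : Hyp G) :
    (stepSEAC G P σ).D = σ.D ⊔ Submodule.span ℚ (Set.range fun i => σ.genPt h G P hH.irr (Sum.inl i)) := by
  rw [stepSEAC_eq_of h hH, adjoinFamily_D]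

end Step

end PState

end PseudoExpChain

end Literature.NumberTheory.Transcendental
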